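import Summits.QuantumFields.YangMills.Theorems.AllWindowsColdBoxBoxHighLineConnectedThreePointRows

/-!
# U5 K3′: the ROW DECOMPOSITION of `κ₃,₀^{μ_{D′}}(X, Y; U)`, PARITY-REFINED (rows₂)

Free-hands helper of the κ-lineage (ym-line-fcl-p3 g27), continuation of ✓`…ConnectedThreePointRows` (`GaussRestrict.tiltCum3_muSet_zero_rows`).  The K3′ term table
(HOME bus 2026-08-30T01:19:30Z, Q8 answer) shows that the `N`-row `κ₃(X,Y;N)` (`N = Uᵒ − P` ∋ the ghost odd cubic tail and the Wilson quintic remainder, sup-bounded) does NOT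
close unsplit in the HIGH window (rel `H⁸·ν`), but its two PARITY SURVIVORS `κ₃(X−Xo, Yo; N) + κ₃(Xo, Y−Yo; N)` do (rel `H⁸β^{−1/2}·ν`, the odd factor `Yo`/`Xo` has
`L²`-size `β^{−3/2}`); likewise the `(Q−C)`-row is put in the odd quintic letters `Xo − Cx`, `Yo − Cy` of ✓7a.  Over
`μ_D := (volume.restrict D).withDensity (ofReal ∘ gaussWeight β H)`, `D` measurable SYMMETRIC of positive Gaussian mass, observables measurable and bounded on `D`:

* ★★ `tiltCum3_muSet_zero_rows₂` (exact identity) / ★★ `abs_tiltCum3_muSet_zero_le_rows₂`: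
  `|κ₃,₀(X,Y;U)| ≤ |κ₃(Lx,Ly;Ve)| (E1) + |κ₃(Cx,Ly;P) + κ₃(Lx,Cy;P)| (E2) + |κ₃(Lx,Ly;Rᵉ)| (RA) + |κ₃(X−Lx,Y;Uᵉ) + κ₃(Lx,Y−Ly;Uᵉ)| (RB)`
  `+ |κ₃(X−Xo,Yo;N) + κ₃(Xo,Y−Yo;N)| (RC split) + |κ₃(Xo−Cx,Ly;P) + κ₃(Lx,Yo−Cy;P)| (RD, quintic letters) + |κ₃(Xo,Y−Ly−Yo;P) + κ₃(X−Lx−Xo,Yo;P)| (RE)`,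
  using the additional parity zeros `κ₃(X−Xo,Y−Yo;N) = κ₃(Xo,Yo;N) = κ₃(X−Lx−Xo,Ly;P) = κ₃(Lx,Y−Ly−Yo;P) = 0` (no new hypotheses: `N` is odd because `P` is).

No definitions; standard axioms.  HONEST LABEL: helper-grade U5 prep; U5, ⟨24004⟩, ⟨24336⟩ remain OPEN; route AllWindowsColdBox is DRAFT; no crux, rung or summit is
proved; **the Yang–Mills mass gap is NOT proved by this file; no summit is proved by a line.**
-/

set_option autoImplicit false

noncomputable section

open MeasureTheory Set

namespace Summit.QuantumFields.YangMills.Theorems.AllWindowsColdBoxBoxHighLine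

namespace GaussRestrict

variable {H : ℕ} {β : ℝ}

/-- ★★ **Row decomposition of `κ₃,₀^{μ_D}(X,Y;U)`, parity-refined (rows₂) — exact identity.**  Same letters as ✓`tiltCum3_muSet_zero_rows`; the `N`-row is split by
parity into its two survivors `κ₃(X−Xo, Yo; N) + κ₃(Xo, Y−Yo; N)` (`N = Uᵒ − P` is odd, `X − Xo` even: `κ₃(X−Xo,Y−Yo;N) = κ₃(Xo,Yo;N) = 0`), and the `(Q−C)`-row is
reduced to the odd quintic letters `κ₃(Xo−Cx, Ly; P) + κ₃(Lx, Yo−Cy; P)` (`κ₃(X−Lx−Xo, Ly; P) = κ₃(Lx, Y−Ly−Yo; P) = 0`). -/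
theorem tiltCum3_muSet_zero_rows₂ (hβ : 0 < β) {D : Set (LandauFree H → E3)} (hDm : MeasurableSet D) (hsym : ∀ a, -a ∈ D ↔ a ∈ D)
    (hD : 0 < ∫ a, D.indicator (fun _ => (1 : ℝ)) a * gaussWeight β H a)
    {X Y U P Ve Lx Ly Cx Cy Xo Yo : (LandauFree H → E3) → ℝ} {B : ℝ} (hB : 0 ≤ B)
    (mX : Measurable X) (mY : Measurable Y) (mU : Measurable U) (mP : Measurable P) (mVe : Measurable Ve) (mLx : Measurable Lx) (mLy : Measurable Ly)
    (mCx : Measurable Cx) (mCy : Measurable Cy) (mXo : Measurable Xo) (mYo : Measurable Yo)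
    (bX : ∀ a ∈ D, |X a| ≤ B) (bY : ∀ a ∈ D, |Y a| ≤ B) (bU : ∀ a ∈ D, |U a| ≤ B) (bU' : ∀ a ∈ D, |U (-a)| ≤ B) (bP : ∀ a ∈ D, |P a| ≤ B)
    (bVe : ∀ a ∈ D, |Ve a| ≤ B) (bLx : ∀ a ∈ D, |Lx a| ≤ B) (bLy : ∀ a ∈ D, |Ly a| ≤ B) (bCx : ∀ a ∈ D, |Cx a| ≤ B) (bCy : ∀ a ∈ D, |Cy a| ≤ B)
    (bXo : ∀ a ∈ D, |Xo a| ≤ B) (bYo : ∀ a ∈ D, |Yo a| ≤ B)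
    (pLx : ∀ a, Lx (-a) = Lx a) (pLy : ∀ a, Ly (-a) = Ly a) (pXo : ∀ a, Xo (-a) = -Xo a) (pYo : ∀ a, Yo (-a) = -Yo a) (pP : ∀ a, P (-a) = -P a)
    (pXe : ∀ a, X (-a) - Xo (-a) = X a - Xo a) (pYe : ∀ a, Y (-a) - Yo (-a) = Y a - Yo a) :
    let μD : Measure (LandauFree H → E3) := (((volume : Measure (LandauFree H → E3)).restrict D).withDensity fun a => ENNReal.ofReal (gaussWeight β H a))
    let Ue : (LandauFree H → E3) → ℝ := fun a => (U a + U (-a)) / 2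
    let N : (LandauFree H → E3) → ℝ := fun a => (U a - U (-a)) / 2 - P a
    let Re : (LandauFree H → E3) → ℝ := fun a => (U a + U (-a)) / 2 - Ve a
    Tilt.tiltCum3 μD U 0 X Y =
      Tilt.tiltCum3 μD Ve 0 Lx Ly +
      (Tilt.tiltCum3 μD P 0 Cx Ly + Tilt.tiltCum3 μD P 0 Lx Cy) +
      Tilt.tiltCum3 μD Re 0 Lx Ly +
      (Tilt.tiltCum3 μD Ue 0 (fun a => X a - Lx a) Y + Tilt.tiltCum3 μD Ue 0 Lx (fun a => Y a - Ly a)) +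
      (Tilt.tiltCum3 μD N 0 (fun a => X a - Xo a) Yo + Tilt.tiltCum3 μD N 0 Xo (fun a => Y a - Yo a)) +
      (Tilt.tiltCum3 μD P 0 (fun a => Xo a - Cx a) Ly + Tilt.tiltCum3 μD P 0 Lx (fun a => Yo a - Cy a)) +
      (Tilt.tiltCum3 μD P 0 Xo (fun a => Y a - Ly a - Yo a) + Tilt.tiltCum3 μD P 0 (fun a => X a - Lx a - Xo a) Yo) := by
  intro μD Ue N Re
  have key := tiltCum3_muSet_zero_rows hβ hDm hsym hD hB mX mY mU mP mVe mLx mLy mCx mCy mXo mYo bX bY bU bU' bP bVe bLx bLy bCx bCy bXo bYo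
    pLx pLy pXo pYo pP pXe pYe
  simp only at key
  rw [show Tilt.tiltCum3 μD U 0 X Y = _ from key]
  -- bounds and measurability of the new slots
  have h3B : 0 ≤ 3 * B := by linarith
  have up : ∀ {G : (LandauFree H → E3) → ℝ}, (∀ a ∈ D, |G a| ≤ B) → ∀ a ∈ D, |G a| ≤ 3 * B := fun {G} h a ha => (h a ha).trans (by linarith)
  have bN : ∀ a ∈ D, |N a| ≤ 3 * B := fun a ha => by
    show |(U a - U (-a)) / 2 - P a| ≤ 3 * B
    have h1 : |(U a - U (-a)) / 2| ≤ B := by rw [abs_div, abs_two]; linarith [abs_sub (U a) (U (-a)), bU a ha, bU' a ha]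
    linarith [abs_sub ((U a - U (-a)) / 2) (P a), bP a ha]
  have bXe : ∀ a ∈ D, |X a - Xo a| ≤ 3 * B := fun a ha => by linarith [abs_sub (X a) (Xo a), bX a ha, bXo a ha]
  have bYe : ∀ a ∈ D, |Y a - Yo a| ≤ 3 * B := fun a ha => by linarith [abs_sub (Y a) (Yo a), bY a ha, bYo a ha]
  have bOCx : ∀ a ∈ D, |Xo a - Cx a| ≤ 3 * B := fun a ha => by linarith [abs_sub (Xo a) (Cx a), bXo a ha, bCx a ha]
  have bOCy : ∀ a ∈ D, |Yo a - Cy a| ≤ 3 * B := fun a ha => by linarith [abs_sub (Yo a) (Cy a), bYo a ha, bCy a ha]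
  have bQOx : ∀ a ∈ D, |X a - Lx a - Xo a| ≤ 3 * B := fun a ha => by
    linarith [abs_sub (X a - Lx a) (Xo a), abs_sub (X a) (Lx a), bX a ha, bLx a ha, bXo a ha]
  have bQOy : ∀ a ∈ D, |Y a - Ly a - Yo a| ≤ 3 * B := fun a ha => by
    linarith [abs_sub (Y a - Ly a) (Yo a), abs_sub (Y a) (Ly a), bY a ha, bLy a ha, bYo a ha]
  have mneg : Measurable fun a : LandauFree H → E3 => U (-a) := mU.comp measurable_neg
  have mN : Measurable N := ((mU.sub mneg).div_const 2).sub mP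
  have mXe : Measurable fun a => X a - Xo a := mX.sub mXo
  have mYe : Measurable fun a => Y a - Yo a := mY.sub mYo
  have mOCx : Measurable fun a => Xo a - Cx a := mXo.sub mCx
  have mOCy : Measurable fun a => Yo a - Cy a := mYo.sub mCy
  have mQOx : Measurable fun a => X a - Lx a - Xo a := (mX.sub mLx).sub mXo
  have mQOy : Measurable fun a => Y a - Ly a - Yo a := (mY.sub mLy).sub mYo
  -- parities
  have pN : ∀ a, N (-a) = -N a := fun a => by
    show (U (-a) - U (- -a)) / 2 - P (-a) = -((U a - U (-a)) / 2 - P a)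
    rw [neg_neg, pP]; ring
  have pYe' : ∀ a, Y (-a) - Yo (-a) = Y a - Yo a := pYe
  have pQOx : ∀ a, X (-a) - Lx (-a) - Xo (-a) = X a - Lx a - Xo a := fun a => by rw [pLx]; linarith [pXe a]
  have pQOy : ∀ a, Y (-a) - Ly (-a) - Yo (-a) = Y a - Ly a - Yo a := fun a => by rw [pLy]; linarith [pYe a]
  -- RC: `X = (X − Xo) + Xo`, `Y = (Y − Yo) + Yo` in the `N` cumulant, two parity zeros
  have eX : (fun a => (X a - Xo a) + Xo a) = X := funext fun a => by ring
  have eY : (fun a => (Y a - Yo a) + Yo a) = Y := funext fun a => by ring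
  have s1 : Tilt.tiltCum3 μD N 0 X Y = Tilt.tiltCum3 μD N 0 (fun a => (X a - Xo a) + Xo a) Y := by rw [eX]
  have h1 := tiltCum3_muSet_zero_add_left hβ hDm hD N h3B mXe mXo mY mN bXe (up bXo) (up bY) bN
  have s2 : Tilt.tiltCum3 μD N 0 (fun a => X a - Xo a) Y = Tilt.tiltCum3 μD N 0 (fun a => X a - Xo a) (fun a => (Y a - Yo a) + Yo a) := by rw [eY]
  have h2 := tiltCum3_muSet_zero_add_right hβ hDm hD N h3B mXe mYe mYo mN bXe bYe (up bYo) bN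
  have s3 : Tilt.tiltCum3 μD N 0 Xo Y = Tilt.tiltCum3 μD N 0 Xo (fun a => (Y a - Yo a) + Yo a) := by rw [eY]
  have h3 := tiltCum3_muSet_zero_add_right hβ hDm hD N h3B mXo mYe mYo mN (up bXo) bYe (up bYo) bN
  have z1 : Tilt.tiltCum3 μD N 0 (fun a => X a - Xo a) (fun a => Y a - Yo a) = 0 :=
    tiltCum3_muSet_zero_eq_zero_of_even_even_odd hβ hDm hsym pXe pYe' pN
  have z2 : Tilt.tiltCum3 μD N 0 Xo Yo = 0 := tiltCum3_muSet_zero_eq_zero_of_odd_odd_odd hβ hDm hsym pXo pYo pN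
  -- RD: `X − Lx − Cx = (X − Lx − Xo) + (Xo − Cx)`, `Y − Ly − Cy = (Y − Ly − Yo) + (Yo − Cy)`, two parity zeros
  have eQCx : (fun a => (X a - Lx a - Xo a) + (Xo a - Cx a)) = fun a => X a - Lx a - Cx a := funext fun a => by ring
  have eQCy : (fun a => (Y a - Ly a - Yo a) + (Yo a - Cy a)) = fun a => Y a - Ly a - Cy a := funext fun a => by ring
  have s4 : Tilt.tiltCum3 μD P 0 (fun a => X a - Lx a - Cx a) Ly = Tilt.tiltCum3 μD P 0 (fun a => (X a - Lx a - Xo a) + (Xo a - Cx a)) Ly := by rw [eQCx]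
  have h4 := tiltCum3_muSet_zero_add_left hβ hDm hD P h3B mQOx mOCx mLy mP bQOx bOCx (up bLy) (up bP)
  have s5 : Tilt.tiltCum3 μD P 0 Lx (fun a => Y a - Ly a - Cy a) = Tilt.tiltCum3 μD P 0 Lx (fun a => (Y a - Ly a - Yo a) + (Yo a - Cy a)) := by rw [eQCy]
  have h5 := tiltCum3_muSet_zero_add_right hβ hDm hD P h3B mLx mQOy mOCy mP (up bLx) bQOy bOCy (up bP)
  have z3 : Tilt.tiltCum3 μD P 0 (fun a => X a - Lx a - Xo a) Ly = 0 := tiltCum3_muSet_zero_eq_zero_of_even_even_odd hβ hDm hsym pQOx pLy pP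
  have z4 : Tilt.tiltCum3 μD P 0 Lx (fun a => Y a - Ly a - Yo a) = 0 := tiltCum3_muSet_zero_eq_zero_of_even_even_odd hβ hDm hsym pLx pQOy pP
  rw [s1, h1, s2, h2, z1, s3, h3, z2, s4, h4, z3, s5, h5, z4]
  ring

/-- ★★ **Row decomposition of `κ₃,₀^{μ_D}(X,Y;U)`, parity-refined (rows₂) — the inequality**: E1, E2 exact rows; RA, RB; RC split by parity
(`|κ₃(X−Xo,Yo;N) + κ₃(Xo,Y−Yo;N)|`); RD in the odd quintic letters (`|κ₃(Xo−Cx,Ly;P) + κ₃(Lx,Yo−Cy;P)|`); RE. -/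
theorem abs_tiltCum3_muSet_zero_le_rows₂ (hβ : 0 < β) {D : Set (LandauFree H → E3)} (hDm : MeasurableSet D) (hsym : ∀ a, -a ∈ D ↔ a ∈ D)
    (hD : 0 < ∫ a, D.indicator (fun _ => (1 : ℝ)) a * gaussWeight β H a)
    {X Y U P Ve Lx Ly Cx Cy Xo Yo : (LandauFree H → E3) → ℝ} {B : ℝ} (hB : 0 ≤ B)
    (mX : Measurable X) (mY : Measurable Y) (mU : Measurable U) (mP : Measurable P) (mVe : Measurable Ve) (mLx : Measurable Lx) (mLy : Measurable Ly)
    (mCx : Measurable Cx) (mCy : Measurable Cy) (mXo : Measurable Xo) (mYo : Measurable Yo)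
    (bX : ∀ a ∈ D, |X a| ≤ B) (bY : ∀ a ∈ D, |Y a| ≤ B) (bU : ∀ a ∈ D, |U a| ≤ B) (bU' : ∀ a ∈ D, |U (-a)| ≤ B) (bP : ∀ a ∈ D, |P a| ≤ B)
    (bVe : ∀ a ∈ D, |Ve a| ≤ B) (bLx : ∀ a ∈ D, |Lx a| ≤ B) (bLy : ∀ a ∈ D, |Ly a| ≤ B) (bCx : ∀ a ∈ D, |Cx a| ≤ B) (bCy : ∀ a ∈ D, |Cy a| ≤ B)
    (bXo : ∀ a ∈ D, |Xo a| ≤ B) (bYo : ∀ a ∈ D, |Yo a| ≤ B)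
    (pLx : ∀ a, Lx (-a) = Lx a) (pLy : ∀ a, Ly (-a) = Ly a) (pXo : ∀ a, Xo (-a) = -Xo a) (pYo : ∀ a, Yo (-a) = -Yo a) (pP : ∀ a, P (-a) = -P a)
    (pXe : ∀ a, X (-a) - Xo (-a) = X a - Xo a) (pYe : ∀ a, Y (-a) - Yo (-a) = Y a - Yo a) :
    let μD : Measure (LandauFree H → E3) := (((volume : Measure (LandauFree H → E3)).restrict D).withDensity fun a => ENNReal.ofReal (gaussWeight β H a))
    let Ue : (LandauFree H → E3) → ℝ := fun a => (U a + U (-a)) / 2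
    let N : (LandauFree H → E3) → ℝ := fun a => (U a - U (-a)) / 2 - P a
    let Re : (LandauFree H → E3) → ℝ := fun a => (U a + U (-a)) / 2 - Ve a
    |Tilt.tiltCum3 μD U 0 X Y| ≤
      |Tilt.tiltCum3 μD Ve 0 Lx Ly| +
      |Tilt.tiltCum3 μD P 0 Cx Ly + Tilt.tiltCum3 μD P 0 Lx Cy| +
      |Tilt.tiltCum3 μD Re 0 Lx Ly| +
      |Tilt.tiltCum3 μD Ue 0 (fun a => X a - Lx a) Y + Tilt.tiltCum3 μD Ue 0 Lx (fun a => Y a - Ly a)| +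
      |Tilt.tiltCum3 μD N 0 (fun a => X a - Xo a) Yo + Tilt.tiltCum3 μD N 0 Xo (fun a => Y a - Yo a)| +
      |Tilt.tiltCum3 μD P 0 (fun a => Xo a - Cx a) Ly + Tilt.tiltCum3 μD P 0 Lx (fun a => Yo a - Cy a)| +
      |Tilt.tiltCum3 μD P 0 Xo (fun a => Y a - Ly a - Yo a) + Tilt.tiltCum3 μD P 0 (fun a => X a - Lx a - Xo a) Yo| := by
  intro μD Ue N Re
  have key := tiltCum3_muSet_zero_rows₂ hβ hDm hsym hD hB mX mY mU mP mVe mLx mLy mCx mCy mXo mYo bX bY bU bU' bP bVe bLx bLy bCx bCy bXo bYo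
    pLx pLy pXo pYo pP pXe pYe
  simp only at key
  rw [show Tilt.tiltCum3 μD U 0 X Y = _ from key]
  have tri : ∀ (a₁ a₂ a₃ a₄ a₅ a₆ a₇ : ℝ), |a₁ + a₂ + a₃ + a₄ + a₅ + a₆ + a₇| ≤ |a₁| + |a₂| + |a₃| + |a₄| + |a₅| + |a₆| + |a₇| := by
    intro a₁ a₂ a₃ a₄ a₅ a₆ a₇
    linarith [abs_add_le (a₁ + a₂ + a₃ + a₄ + a₅ + a₆) a₇, abs_add_le (a₁ + a₂ + a₃ + a₄ + a₅) a₆, abs_add_le (a₁ + a₂ + a₃ + a₄) a₅,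
      abs_add_le (a₁ + a₂ + a₃) a₄, abs_add_le (a₁ + a₂) a₃, abs_add_le a₁ a₂]
  exact tri _ _ _ _ _ _ _

end GaussRestrict

end Summit.QuantumFields.YangMills.Theorems.AllWindowsColdBoxBoxHighLine

end
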